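import Summits.Ventures.HSemireg.SignedPureWeilLadder

/-!
# Venture HSemireg — signed pure-Weil designs: the TEST-FUNCTION (dual) criterion for supports, the slab obstructions for every n,
# and the minimal designs s(3) ≤ 14, s(4) ≤ 28 by explicit witnesses (t-20's LEMMA S printed «8 ≤ s(3) ≤ 16, 16 ≤ s(4) ≤ 32»)

HONEST FRAMING. Part of the Lean index of the computation cell `pub-hsemireg` (Sunday typer seat p9, § g = 8; family B row **B20-3** of
`target-g8/CENSUS.md`: «SIGNED pure-Weil unit-graph cycles … bounds s(3) ∈ [8,16], s(4) ∈ [16,32]»). FINITE GAUSSIAN-INTEGER ARITHMETIC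
ONLY, in the vocabulary of `SignedPureWeilLadder.lean` (`Letter n = Fin n → Fin 4`, `Eps n = Fin n → Fin 3`, `vchi`, `vmoment`, `plus`,
`minus`, `supp`; PURE = all 3ⁿ − 2 visible moments vanish, W-ALIVE = `m̂(+,…,+) ≠ 0`, both carried as explicit hypotheses). No abelian
variety, cycle or class is constructed; t-20's DICTIONARY (LEMMA W, filler-free form) is TEXT OF RECORD, not a binder; nothing here says
that HC ∕ HC_CM ∕ HC_AV holds; no object is certified (row B20-3: «class witnesses, not objects»); no Literature fact is declared.

TEXT OF RECORD (quoted, not interpreted). t-20, `target-g8/FAMILY-B-G8-t20.md` v1.25 §2.6: «LEMMA S: s(1) = 2, s(2) = 4; s(n) ≥ 2 s(n−1)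
…; hence 8 ≤ s(3) ≤ 16, 16 ≤ s(4) ≤ 32.» (s(n) = the minimal support of a filler-free signed pure-Weil W-alive unit-graph design on
E_iⁿ × E_iⁿ, i.e. of an integer `m` on (ℤ∕4)ⁿ that is PURE and W-ALIVE.)

WHAT THIS FILE PROVES.
§1 **THE TEST-FUNCTION CRITERION** (every n ≥ 1). A coefficient table `c : Eps n → ℤ[i]` defines the test function
`F_c(x) = Σ_ε c(ε)·i^{ε·x}` (`testFun`); for every integer design `Σ_x F_c(x)·m(x) = Σ_ε c(ε)·m̂(ε)` (`sum_testFun_mul`, a swap of two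
finite sums), which for a PURE design collapses to `c(+)·m̂(+) + c(−)·m̂(−)` (`sum_testFun_mul_of_pure`). Hence
**`exists_mem_of_certificate`**: if `c(−) = 0`, `c(+) ≠ 0` and `F_c` vanishes outside a set `H`, then every pure W-alive design has a
support letter IN `H` (else the left side is 0 and `c(+)·m̂(+) = 0`). [`H` is an OBSTRUCTION; `c` is its CERTIFICATE.]
§2 **PRODUCT CERTIFICATES AND THE SLAB OBSTRUCTIONS** (every n ≥ 1). For per-factor triples `a_k = (a_k(0), a_k(+), a_k(−))` the product
`Π_k (a_k(0) + a_k(+) i^{x_k} + a_k(−) i^{−x_k})` is `F_c` with `c(ε) = Π_k a_k(ε_k)` (`prodFun_eq_testFun`, via `Finset.prod_univ_sum` and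
`prod_unitTab`); so if one factor has no `i^{−x_k}` term and every factor has an `i^{x_k}` term, every pure W-alive design has a support
letter at which NO factor vanishes (`exists_mem_of_prod`). With the factors `i^{y} − i^{t}` (zero only at y = t) and
`i^{y} − (i^{u} + i^{u'}) + i^{u+u'}·i^{−y} = i^{−y}(i^{y} − i^{u})(i^{y} − i^{u'})` (zero only at y ∈ {u, u'}):
**`exists_mem_slab`** — for every n ≥ 1, every factor k₀, every t and all u, u' : Fin n → Fin 4, a pure W-alive design has a support
letter x with `x_{k₀} ≠ t` and `x_k ∉ {u_k, u'_k}` for all k ≠ k₀. At n = 3 these are the 432 twelve-point sets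
`{x_{k₀} ≠ t} × P × P'` (P, P' two-element), the smallest obstructions met by the search below; at n = 4 they are 24-point sets.
§3 **s(3) ≤ 14**: the explicit design `design14` (values ±1, ±2 on 14 letters of (ℤ∕4)³) is PURE, has `m̂(+,+,+) = 8 + 8i`, and support
14 (`design14_certificate`, kernel `decide`) — two letters below the tensor rung `rung3` (support 16) of `SignedPureWeilLadder.lean`. With
`eight_le_card_support_pure` the kernel bracket is 8 ≤ s(3) ≤ 14 (`s3_bracket`).
§4 **THE SLICE STEP WITH AN ARBITRARY BASE** (`card_support_step`: s(n+1) ≥ 2·(any lower bound for s(n)), n ≥ 1 — LEMMA S's induction step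
restated), **`s4_ge_28_of_s3_ge_14`** (GIVEN the machine-checked «every pure W-alive design on (ℤ∕4)³ has ≥ 14 letters», every pure
W-alive design on (ℤ∕4)⁴ has ≥ 28 letters) and `card_support_ge_of_s3` (7·2ⁿ⁻² ≤ s(n) for every n ≥ 3 under the same hypothesis).
§5 **s(4) ≤ 28**: the explicit design `design28` (values ±1, ±2 on 28 letters of (ℤ∕4)⁴; its four slices along factor 0 have 7 letters each
and their six pairwise sums ∕ differences are 14-letter designs) is PURE, has `m̂(+,+,+,+) = −32`, and support 28 (`design28_certificate`,
kernel `decide`) — four letters below t-20's T32 (`rung4_certificate`); `s4_bracket`: 16 ≤ s(4) ≤ 28 unconditionally in the kernel, and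
s(4) = 28 given the machine statement (LEMMA S's recursion is an EQUALITY from n = 3 to n = 4).

WHAT IS MACHINE, NOT KERNEL (numbers of record in HOME/p9/S3-MINIMAL-SUPPORT-p9g6.md): s(3) = 14 EXACTLY. The lower bound s(3) ≥ 14 is the
statement that no 13-element subset of (ℤ∕4)³ meets every member of an explicit family 𝓕 of 17 072 obstructions (the 432 slabs and the
images under translations ∕ factor permutations ∕ x ↦ −x of the 32 certified sets of `SignedPureWeilObstructionsN3.lean`, sizes 14–23);
it was checked by a lazy-oracle depth-first search (C) and independently as a SAT instance (kissat ∕ cadical UNSAT + drat-trim) — kit job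
ids in that file. It is NOT a theorem of this file; the theorems that use it carry it as an explicit hypothesis. Also machine there:
all 22 368 fourteen-letter supports at n = 3 (54 Γ-orbits), all 768 twenty-eight-letter supports at n = 4 (2 Γ-orbits), and «no two of the
latter meet in 14 letters» (so no equality-type 56-letter design exists at n = 5).

WHAT IS NOT HERE. s(5) (machine bracket [57, 112]); LEMMA W; anything about sheaves, fillers or semiregularity.
-/

namespace Summit.Ventures.HSemireg.SignedWeilDesignN

open Finset

variable {n : ℕ}

/-! ## §1 The test-function criterion -/

/-- The test function `F_c(x) = Σ_ε c(ε)·i^{ε·x}` of a coefficient table `c : Eps n → ℤ[i]` (a function on (ℤ∕4)ⁿ whose Fourier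
support lies in the 3ⁿ patterns {0, ±1}ⁿ). [definition of this file] -/
def testFun (c : Eps n → GaussianInt) (x : Letter n) : GaussianInt := ∑ ε, c ε * vchi ε x

/-- **Σ_x F_c(x)·m(x) = Σ_ε c(ε)·m̂(ε)** (swap the two finite sums). -/
theorem sum_testFun_mul (c : Eps n → GaussianInt) (m : Letter n → ℤ) :
    (∑ x, testFun c x * (m x : GaussianInt)) = ∑ ε, c ε * vmoment m ε := by
  simp only [testFun, vmoment, Finset.sum_mul, Finset.mul_sum]
  rw [Finset.sum_comm]
  refine Finset.sum_congr rfl (fun ε _ => Finset.sum_congr rfl (fun x _ => ?_))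
  ring

/-- For `n ≥ 1` the two invisible patterns differ. -/
theorem plus_ne_minus (hn : 0 < n) : (plus : Eps n) ≠ minus := by
  intro h
  have := congrFun h ⟨0, hn⟩
  simp [plus, minus] at this

/-- **For a PURE design the pairing collapses to the two invisible patterns:** `Σ_x F_c(x)·m(x) = c(+)·m̂(+) + c(−)·m̂(−)`. -/
theorem sum_testFun_mul_of_pure (hn : 0 < n) (c : Eps n → GaussianInt) (m : Letter n → ℤ)
    (hpure : ∀ ε : Eps n, ε ≠ plus → ε ≠ minus → vmoment m ε = 0) :
    (∑ x, testFun c x * (m x : GaussianInt)) = c plus * vmoment m plus + c minus * vmoment m minus := by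
  rw [sum_testFun_mul]
  rw [Finset.sum_eq_add_of_mem (plus : Eps n) minus (Finset.mem_univ _) (Finset.mem_univ _) (plus_ne_minus hn)]
  intro ε _ hε
  rw [hpure ε hε.1 hε.2, mul_zero]

/-- **THE TEST-FUNCTION CRITERION.** If `c(−) = 0`, `c(+) ≠ 0` and `F_c` vanishes outside `H`, then every PURE W-ALIVE integer design
on (ℤ∕4)ⁿ has a support letter in `H`: otherwise `Σ_x F_c(x)·m(x) = 0` termwise, while it equals `c(+)·m̂(+,…,+) ≠ 0`. -/
theorem exists_mem_of_certificate (hn : 0 < n) (c : Eps n → GaussianInt) (H : Finset (Letter n))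
    (hminus : c minus = 0) (hplus : c plus ≠ 0) (hvan : ∀ x, x ∉ H → testFun c x = 0)
    (m : Letter n → ℤ) (hpure : ∀ ε : Eps n, ε ≠ plus → ε ≠ minus → vmoment m ε = 0) (halive : vmoment m plus ≠ 0) :
    ∃ x ∈ H, m x ≠ 0 := by
  by_contra hno
  push Not at hno
  have hzero : (∑ x, testFun c x * (m x : GaussianInt)) = 0 := by
    refine Finset.sum_eq_zero (fun x _ => ?_)
    by_cases hx : x ∈ H
    · rw [hno x hx]; simp
    · rw [hvan x hx, zero_mul]
  rw [sum_testFun_mul_of_pure hn c m hpure, hminus, zero_mul, add_zero] at hzero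
  rcases mul_eq_zero.mp hzero with h | h
  · exact hplus h
  · exact halive h

/-- Support form of the criterion: `supp m ∩ H` is non-empty. -/
theorem supp_inter_nonempty_of_certificate (hn : 0 < n) (c : Eps n → GaussianInt) (H : Finset (Letter n))
    (hminus : c minus = 0) (hplus : c plus ≠ 0) (hvan : ∀ x, x ∉ H → testFun c x = 0)
    (m : Letter n → ℤ) (hpure : ∀ ε : Eps n, ε ≠ plus → ε ≠ minus → vmoment m ε = 0) (halive : vmoment m plus ≠ 0) :
    (supp m ∩ H).Nonempty := by
  obtain ⟨x, hx, hmx⟩ := exists_mem_of_certificate hn c H hminus hplus hvan m hpure halive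
  exact ⟨x, Finset.mem_inter.mpr ⟨by simp [supp, hmx], hx⟩⟩

/-! ## §2 Product certificates and the slab obstructions -/

/-- The product test function `Π_k (a_k(0) + a_k(+)·i^{x_k} + a_k(−)·i^{−x_k})` of per-factor coefficient triples
`a : Fin n → Fin 3 → ℤ[i]` (code 0 ↦ exponent 0, 1 ↦ +1, 2 ↦ −1, as in `coef`). [definition of this file] -/
def prodFun (a : Fin n → Fin 3 → GaussianInt) (x : Letter n) : GaussianInt := ∏ k, ∑ e : Fin 3, a k e * unitTab (coef e * x k)

/-- `Π_k i^{f k} = i^{Σ_k f k}` on the table. -/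
theorem prod_unitTab (s : Finset (Fin n)) (f : Fin n → Fin 4) : (∏ k ∈ s, unitTab (f k)) = unitTab (∑ k ∈ s, f k) := by
  induction s using Finset.induction_on with
  | empty => simp [unitTab]
  | insert k s hk ih => rw [Finset.prod_insert hk, Finset.sum_insert hk, unitTab_add, ih]

/-- **A product of factors is the test function of the product table:** `prodFun a = F_c` with `c(ε) = Π_k a_k(ε_k)`. -/
theorem prodFun_eq_testFun (a : Fin n → Fin 3 → GaussianInt) (x : Letter n) :
    prodFun a x = testFun (fun ε => ∏ k, a k (ε k)) x := by
  unfold prodFun testFun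
  rw [Finset.prod_univ_sum]
  refine Finset.sum_congr rfl (fun ε _ => ?_)
  rw [Finset.prod_mul_distrib, prod_unitTab, vchi, expo]

/-- **PRODUCT OBSTRUCTIONS.** If some factor `k₀` has no `i^{−x}` term (`a k₀ 2 = 0`) and every factor has an `i^{x}` term
(`a k 1 ≠ 0`), every PURE W-ALIVE design has a support letter at which no factor vanishes. -/
theorem exists_mem_of_prod (hn : 0 < n) (a : Fin n → Fin 3 → GaussianInt) (k₀ : Fin n) (hk₀ : a k₀ 2 = 0)
    (hone : ∀ k, a k 1 ≠ 0)
    (m : Letter n → ℤ) (hpure : ∀ ε : Eps n, ε ≠ plus → ε ≠ minus → vmoment m ε = 0) (halive : vmoment m plus ≠ 0) :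
    ∃ x, m x ≠ 0 ∧ ∀ k, (∑ e : Fin 3, a k e * unitTab (coef e * x k)) ≠ 0 := by
  classical
  let H : Finset (Letter n) := Finset.univ.filter (fun x => ∀ k, (∑ e : Fin 3, a k e * unitTab (coef e * x k)) ≠ 0)
  have hminus : (fun ε : Eps n => ∏ k, a k (ε k)) minus = 0 :=
    Finset.prod_eq_zero (Finset.mem_univ k₀) (by simpa [minus] using hk₀)
  have hplus : (fun ε : Eps n => ∏ k, a k (ε k)) plus ≠ 0 :=
    Finset.prod_ne_zero_iff.mpr (fun k _ => by simpa [plus] using hone k)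
  have hvan : ∀ x, x ∉ H → testFun (fun ε : Eps n => ∏ k, a k (ε k)) x = 0 := by
    intro x hx
    rw [← prodFun_eq_testFun]
    simp only [H, Finset.mem_filter, Finset.mem_univ, true_and, not_forall, not_not] at hx
    obtain ⟨k, hk⟩ := hx
    exact Finset.prod_eq_zero (Finset.mem_univ k) hk
  obtain ⟨x, hx, hmx⟩ := exists_mem_of_certificate hn _ H hminus hplus hvan m hpure halive
  simp only [H, Finset.mem_filter, Finset.mem_univ, true_and] at hx
  exact ⟨x, hmx, hx⟩

/-- The point factor `i^{y} − i^{t}`: coefficients `(−i^t, 1, 0)`. [definition of this file] -/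
def ptFac (t : Fin 4) : Fin 3 → GaussianInt := ![-unitTab t, 1, 0]

/-- The pair factor `i^{y} − (i^{u} + i^{u'}) + i^{u+u'}·i^{−y} = i^{−y}(i^{y} − i^{u})(i^{y} − i^{u'})`: coefficients
`(−(i^u + i^{u'}), 1, i^{u+u'})`. [definition of this file] -/
def pairFac (u u' : Fin 4) : Fin 3 → GaussianInt := ![-(unitTab u + unitTab u'), 1, unitTab (u + u')]

/-- The point factor vanishes exactly at `y = t`. Kernel `decide` (16 cases). -/
theorem ptFac_ne_zero_iff : ∀ t y : Fin 4, (∑ e : Fin 3, ptFac t e * unitTab (coef e * y)) ≠ 0 ↔ y ≠ t := by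
  simp only [Fin.sum_univ_three]
  decide

/-- The pair factor vanishes exactly at `y ∈ {u, u'}`. Kernel `decide` (64 cases). -/
theorem pairFac_ne_zero_iff : ∀ u u' y : Fin 4, (∑ e : Fin 3, pairFac u u' e * unitTab (coef e * y)) ≠ 0 ↔ (y ≠ u ∧ y ≠ u') := by
  simp only [Fin.sum_univ_three]
  decide

/-- **THE SLAB OBSTRUCTIONS (every n ≥ 1).** For every factor `k₀`, every letter value `t` and all `u u' : Fin n → Fin 4`, a PURE W-ALIVE
integer design on (ℤ∕4)ⁿ has a support letter `x` with `x_{k₀} ≠ t` and `x_k ∉ {u_k, u'_k}` for every `k ≠ k₀`. At n = 3 these are the 432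
twelve-point sets `{x_{k₀} ≠ t} × P × P'` (P, P' two-element subsets of ℤ∕4) — the smallest obstructions met by the machine search. -/
theorem exists_mem_slab (hn : 0 < n) (m : Letter n → ℤ)
    (hpure : ∀ ε : Eps n, ε ≠ plus → ε ≠ minus → vmoment m ε = 0) (halive : vmoment m plus ≠ 0)
    (k₀ : Fin n) (t : Fin 4) (u u' : Fin n → Fin 4) :
    ∃ x, m x ≠ 0 ∧ x k₀ ≠ t ∧ ∀ k, k ≠ k₀ → (x k ≠ u k ∧ x k ≠ u' k) := by
  let a : Fin n → Fin 3 → GaussianInt := fun k => if k = k₀ then ptFac t else pairFac (u k) (u' k)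
  have hk₀ : a k₀ 2 = 0 := by simp [a, ptFac]
  have hone : ∀ k, a k 1 ≠ 0 := by
    intro k
    by_cases hk : k = k₀
    · simp [a, hk, ptFac]
    · simp [a, hk, pairFac]
  obtain ⟨x, hmx, hx⟩ := exists_mem_of_prod hn a k₀ hk₀ hone m hpure halive
  refine ⟨x, hmx, ?_, fun k hk => ?_⟩
  · have := hx k₀
    simp only [a, if_pos rfl] at this
    exact (ptFac_ne_zero_iff t (x k₀)).mp this
  · have := hx k
    simp only [a, if_neg hk] at this
    exact (pairFac_ne_zero_iff (u k) (u' k) (x k)).mp this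

/-! ## §3 s(3) ≤ 14: an explicit design -/

/-- **A SIGNED PURE-WEIL W-ALIVE DESIGN ON (ℤ∕4)³ WITH 14 LETTERS** (found by a support-descent search, verified here):
`−Γ_{(0,0,2)} + 2Γ_{(0,1,3)} − Γ_{(0,2,0)} − Γ_{(1,1,3)} + Γ_{(1,3,1)} + Γ_{(2,0,0)} − 2Γ_{(2,0,1)} + 2Γ_{(2,1,2)} − Γ_{(2,2,2)} − 2Γ_{(3,0,3)}
+ Γ_{(3,1,1)} − 2Γ_{(3,2,2)} + 2Γ_{(3,3,2)} + Γ_{(3,3,3)}` (exponent vectors; the letter of factor k is `i^{x_k}`). [definition of this file] -/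
def design14 : Letter 3 → ℤ := fun x =>
  if x = ![0,0,2] then -1 else if x = ![0,1,3] then 2 else if x = ![0,2,0] then -1 else if x = ![1,1,3] then -1 else
  if x = ![1,3,1] then 1 else if x = ![2,0,0] then 1 else if x = ![2,0,1] then -2 else if x = ![2,1,2] then 2 else
  if x = ![2,2,2] then -1 else if x = ![3,0,3] then -2 else if x = ![3,1,1] then 1 else if x = ![3,2,2] then -2 else
  if x = ![3,3,2] then 2 else if x = ![3,3,3] then 1 else 0

/-- **`design14` IS PURE, W-ALIVE WITH m̂(+,+,+) = 8 + 8i, AND HAS SUPPORT 14** — so s(3) ≤ 14 (t-20 printed s(3) ≤ 16 via the tensor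
rung; `eight_le_card_support_pure` gives 8 ≤ s(3)). Kernel `decide` (25 visible patterns × 64 letters). -/
theorem design14_certificate :
    (∀ ε : Eps 3, ε ≠ plus → ε ≠ minus → vmoment design14 ε = 0) ∧ vmoment design14 plus = ⟨8, 8⟩ ∧ (supp design14).card = 14 := by
  refine ⟨?_, by decide +kernel, by decide +kernel⟩
  decide +kernel

/-- **8 ≤ s(3) ≤ 14 in the kernel:** the lower half for every pure W-alive design, the upper half by the witness. -/
theorem s3_bracket :
    (∀ m : Letter 3 → ℤ, (∀ ε : Eps 3, ε ≠ plus → ε ≠ minus → vmoment m ε = 0) → vmoment m plus ≠ 0 → 8 ≤ (supp m).card) ∧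
    (∃ m : Letter 3 → ℤ, (∀ ε : Eps 3, ε ≠ plus → ε ≠ minus → vmoment m ε = 0) ∧ vmoment m plus ≠ 0 ∧ (supp m).card = 14) := by
  refine ⟨fun m hp ha => eight_le_card_support_pure m hp ha, ⟨design14, design14_certificate.1, ?_, design14_certificate.2.2⟩⟩
  rw [design14_certificate.2.1]
  decide

/-! ## §4 The slice step of LEMMA S with an arbitrary base, and 28 ≤ s(4) from s(3) ≥ 14 -/

/-- **THE SLICE STEP OF LEMMA S WITH AN ARBITRARY BASE:** if every pure W-alive design on (ℤ∕4)ⁿ (n ≥ 1) has at least `b` support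
letters, every pure W-alive design on (ℤ∕4)ⁿ⁺¹ has at least `2b` (the four slice-pair designs along factor 0 are pure and W-alive by
`sl_pure` ∕ `sl_alive`, and `Σ_a (#slice_a + #slice_{a+1}) = 2·#supp`). The proof of `two_pow_le_card_support_pure`, restated. -/
theorem card_support_step (hn : 0 < n) (b : ℕ)
    (hb : ∀ m' : Letter n → ℤ, (∀ ε : Eps n, ε ≠ plus → ε ≠ minus → vmoment m' ε = 0) → vmoment m' plus ≠ 0 → b ≤ (supp m').card)
    (m : Letter (n + 1) → ℤ) (hpure : ∀ ε : Eps (n + 1), ε ≠ plus → ε ≠ minus → vmoment m ε = 0) (halive : vmoment m plus ≠ 0) :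
    2 * b ≤ (supp m).card := by
  have hsl : ∀ a : Fin 4, b ≤ (supp (sl m a)).card :=
    fun a => hb (sl m a) (sl_pure m hpure a) (sl_alive hn m hpure halive a)
  have hsum : 4 * b ≤ ∑ a : Fin 4, (supp (sl m a)).card := by
    calc 4 * b = ∑ _a : Fin 4, b := by simp
      _ ≤ ∑ a : Fin 4, (supp (sl m a)).card := Finset.sum_le_sum (fun a _ => hsl a)
  have hle : (∑ a : Fin 4, (supp (sl m a)).card) ≤ 2 * (supp m).card := by
    calc (∑ a : Fin 4, (supp (sl m a)).card)
        ≤ ∑ a : Fin 4, ((sliceSupp m a).card + (sliceSupp m (a + 1)).card) :=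
          Finset.sum_le_sum (fun a _ => card_supp_sl_le m a)
      _ = (∑ a : Fin 4, (sliceSupp m a).card) + ∑ a : Fin 4, (sliceSupp m (a + 1)).card := Finset.sum_add_distrib
      _ = 2 * (supp m).card := by rw [sum_card_slices_shift, sum_card_slices]; ring
  omega

/-- **28 ≤ s(4) FROM s(3) ≥ 14.** The hypothesis — every pure W-alive integer design on (ℤ∕4)³ has at least 14 support letters — is the
MACHINE-CHECKED half of «s(3) = 14» (hitting-set search ×2, see the module docstring), NOT a theorem of this file; GIVEN it, the slice
step gives 28 ≤ #supp for every pure W-alive design on (ℤ∕4)⁴ (t-20 printed 16 ≤ s(4) ≤ 32; the kernel's unconditional bracket stays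
[16, 32], `sixteen_le_card_support_pure` ∕ `rung4_certificate`). -/
theorem s4_ge_28_of_s3_ge_14
    (h14 : ∀ m' : Letter 3 → ℤ, (∀ ε : Eps 3, ε ≠ plus → ε ≠ minus → vmoment m' ε = 0) → vmoment m' plus ≠ 0 → 14 ≤ (supp m').card)
    (m : Letter 4 → ℤ) (hpure : ∀ ε : Eps 4, ε ≠ plus → ε ≠ minus → vmoment m ε = 0) (halive : vmoment m plus ≠ 0) :
    28 ≤ (supp m).card := by
  have := card_support_step (n := 3) (by norm_num) 14 h14 m hpure halive
  omega

/-- **7·2ⁿ⁻² ≤ s(n) FOR EVERY n ≥ 3, FROM s(3) ≥ 14** (same machine hypothesis; LEMMA S's recursion iterated from the base 14 instead of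
8: 14, 28, 56, 112, …). -/
theorem card_support_ge_of_s3
    (h14 : ∀ m' : Letter 3 → ℤ, (∀ ε : Eps 3, ε ≠ plus → ε ≠ minus → vmoment m' ε = 0) → vmoment m' plus ≠ 0 → 14 ≤ (supp m').card) :
    ∀ n, 3 ≤ n → ∀ m : Letter n → ℤ,
      (∀ ε : Eps n, ε ≠ plus → ε ≠ minus → vmoment m ε = 0) → vmoment m plus ≠ 0 → 7 * 2 ^ (n - 2) ≤ (supp m).card := by
  intro n hn
  induction n, hn using Nat.le_induction with
  | base => intro m hp ha; simpa using h14 m hp ha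
  | succ k hk ih =>
    intro m hp ha
    have hstep := card_support_step (n := k) (by omega) (7 * 2 ^ (k - 2)) ih m hp ha
    obtain ⟨j, rfl⟩ : ∃ j, k = j + 3 := ⟨k - 3, by omega⟩
    simp only [show j + 3 + 1 - 2 = (j + 1) + 1 from by omega, show j + 3 - 2 = j + 1 from by omega, pow_succ] at hstep ⊢
    linarith

/-! ## §5 s(4) ≤ 28: an explicit design on (ℤ∕4)⁴ (four letters below t-20's tensor design T32) -/

/-- The value table of `design28` (indexed by x₀, x₁, x₂, x₃). [definition of this file] -/
def design28Tab : Fin 4 → Fin 4 → Fin 4 → Fin 4 → ℤ := ![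
    ![![![-1, 0, 0, 0], ![0, 0, 0, 0], ![0, 0, 0, 0], ![0, 0, 0, 1]], ![![0, 2, 0, 0], ![0, 0, -1, 0], ![0, 0, 0, 0], ![-1, 0, 0, 0]], ![![0, 0, -1, 0], ![0, 0, 0, 1], ![0, 0, 0, 0], ![0, 0, 0, 0]], ![![0, 0, 0, 0], ![0, 0, 0, 0], ![0, 0, 0, 0], ![0, 0, 0, 0]]],
    ![![![0, 0, 0, 0], ![0, 0, 0, 0], ![0, 0, 0, 0], ![0, 0, 0, 0]], ![![0, 0, -1, 0], ![0, 0, 0, 1], ![0, 0, 0, 0], ![0, 0, 0, 0]], ![![0, 0, 0, 1], ![-2, 0, 0, 0], ![0, 1, 0, 0], ![0, 0, 0, 0]], ![![0, 0, 0, 0], ![0, 1, 0, 0], ![0, 0, -1, 0], ![0, 0, 0, 0]]],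
    ![![![0, 0, 0, 0], ![0, 0, 0, 0], ![-1, 0, 0, 0], ![0, 1, 0, 0]], ![![0, 0, 0, 0], ![0, 0, 0, 0], ![0, 0, 0, 0], ![0, 0, 0, 0]], ![![0, 0, 0, 0], ![0, 1, 0, 0], ![0, 0, -1, 0], ![0, 0, 0, 0]], ![![0, 0, 0, 0], ![0, 0, -1, 0], ![0, 0, 0, 2], ![-1, 0, 0, 0]]],
    ![![![0, 0, 0, 1], ![0, 0, 0, 0], ![0, 1, 0, 0], ![0, 0, -2, 0]], ![![-1, 0, 0, 0], ![0, 0, 0, 0], ![0, 0, 0, 0], ![0, 0, 0, 1]], ![![0, 0, 0, 0], ![0, 0, 0, 0], ![0, 0, 0, 0], ![0, 0, 0, 0]], ![![0, 0, 0, 0], ![0, 0, 0, 0], ![-1, 0, 0, 0], ![0, 1, 0, 0]]]]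

/-- **A SIGNED PURE-WEIL W-ALIVE DESIGN ON (ℤ∕4)⁴ WITH 28 LETTERS** (values ±1, ±2), found as a «K4 of 14-supports»: its four slices
along factor 0 have 7 letters each, pairwise disjoint supports, and the six pairwise sums ∕ differences of slices are 14-letter pure designs on
(ℤ∕4)³ — the equality case of LEMMA S's slice step with base 14. As a cycle: `− Γ(0,0,0,0) + Γ(0,0,3,3) + 2Γ(0,1,0,1) − Γ(0,1,1,2) − Γ(0,1,3,0) − Γ(0,2,0,2) + Γ(0,2,1,3) − Γ(1,1,0,2) + Γ(1,1,1,3) + Γ(1,2,0,3) − 2Γ(1,2,1,0) + Γ(1,2,2,1) + Γ(1,3,1,1) − Γ(1,3,2,2) − Γ(2,0,2,0) + Γ(2,0,3,1) + Γ(2,2,1,1) − Γ(2,2,2,2) − Γ(2,3,1,2) + 2Γ(2,3,2,3) − Γ(2,3,3,0) + Γ(3,0,0,3) + Γ(3,0,2,1) − 2Γ(3,0,3,2) − Γ(3,1,0,0) + Γ(3,1,3,3) − Γ(3,3,2,0) + Γ(3,3,3,1)`. [definition of this file] -/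
def design28 : Letter 4 → ℤ := fun x => design28Tab (x 0) (x 1) (x 2) (x 3)

/-- **`design28` IS PURE, W-ALIVE WITH m̂(+,+,+,+) = −32, AND HAS SUPPORT 28** — so s(4) ≤ 28 < 32 (t-20's T32, `rung4_certificate`).
Kernel `decide` (79 visible patterns × 256 letters). -/
theorem design28_certificate :
    (∀ ε : Eps 4, ε ≠ plus → ε ≠ minus → vmoment design28 ε = 0) ∧ vmoment design28 plus = -32 ∧ (supp design28).card = 28 := by
  refine ⟨?_, by decide +kernel, by decide +kernel⟩
  decide +kernel

/-- **16 ≤ s(4) ≤ 28 in the kernel** (lower half `sixteen_le_card_support_pure`, upper half the witness), and **s(4) = 28 given the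
machine-checked s(3) ≥ 14** (`s4_ge_28_of_s3_ge_14`): LEMMA S's recursion s(n+1) ≥ 2·s(n) is an equality from n = 3 to n = 4. -/
theorem s4_bracket :
    (∀ m : Letter 4 → ℤ, (∀ ε : Eps 4, ε ≠ plus → ε ≠ minus → vmoment m ε = 0) → vmoment m plus ≠ 0 → 16 ≤ (supp m).card) ∧
    (∃ m : Letter 4 → ℤ, (∀ ε : Eps 4, ε ≠ plus → ε ≠ minus → vmoment m ε = 0) ∧ vmoment m plus ≠ 0 ∧ (supp m).card = 28) ∧
    ((∀ m' : Letter 3 → ℤ, (∀ ε : Eps 3, ε ≠ plus → ε ≠ minus → vmoment m' ε = 0) → vmoment m' plus ≠ 0 → 14 ≤ (supp m').card) →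
      ∀ m : Letter 4 → ℤ, (∀ ε : Eps 4, ε ≠ plus → ε ≠ minus → vmoment m ε = 0) → vmoment m plus ≠ 0 → 28 ≤ (supp m).card) := by
  refine ⟨fun m hp ha => sixteen_le_card_support_pure m hp ha, ⟨design28, design28_certificate.1, ?_, design28_certificate.2.2⟩,
    fun h14 m hp ha => s4_ge_28_of_s3_ge_14 h14 m hp ha⟩
  rw [design28_certificate.2.1]
  decide

end Summit.Ventures.HSemireg.SignedWeilDesignN
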